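import Mathlib
import HarnessLib

/-!
# Tilted anti-concentration: flatness and small balls from a density bound

An abstract measure-theoretic lemma behind Laplace–Remez type estimates for tilted laws.  On a
compact space with a finite measure `μ`, let `F ≥ 0` be a continuous amplitude and `w ≥ 0` a
continuous weight (e.g. `w = e^{-βS}`) with the DENSITY BOUND `w ≤ K · Z`, `Z = ∫ w dμ > 0`, and
suppose the RELATIVE SMALL BALLS `μ{F ≤ ε F(x₀)} ≤ C_R ε^c` for every `x₀` with `F(x₀) > 0` and every
`ε > 0`.  Then, with `M = ∫ F w dμ / Z` the tilted mean:

* (a) flatness: `F(x₀) ≤ 2 (2 K C_R + 1)^{1/c} · M` for every `x₀`;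
* (b) tilted small balls: `∫ 1{F ≤ ε M} w dμ / Z ≤ K C_R ε^c` for every `ε > 0` (when `M > 0`).

Proof: (a) the weighted mass of the deep sublevel set `{F ≤ δ sup F}`, `δ = (2KC_R+1)^{-1/c}`, is at
most `K Z μ{F ≤ δ sup F} ≤ Z/2`, so half of the tilted mass sees `F > δ sup F`; (b) `{F ≤ εM} ⊆
{F ≤ ε sup F}` and the density bound.  No local Remez lemma is used.  (Folklore; this is the
"untilt + anti-concentration" step of Laplace-type lower bounds, cf. the use of Remez inequalities in
A. Brudnyi, Ann. of Math. 149 (1999) 511–533.)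
-/

namespace Literature.MeasureTheory.Integral

open _root_.MeasureTheory _root_.Set _root_.Filter
open scoped BigOperators

/-- **Tilted anti-concentration.**  On a compact space with a finite measure `μ`, a continuous amplitude
`F ≥ 0`, a continuous weight `w ≥ 0` with total mass `Z = ∫ w dμ > 0` and DENSITY BOUND `w ≤ K · Z`, and
RELATIVE SMALL BALLS `μ{F ≤ ε F(x₀)} ≤ C_R ε^c` (all `x₀` with `F(x₀) > 0`, all `ε > 0`): (a)
`F(x₀) ≤ 2(2KC_R+1)^{1/c} · M` for every `x₀`, and (b) if `M > 0` then `∫ 1{F ≤ εM} w dμ / Z ≤ K C_R ε^c`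
for every `ε > 0`, where `M = ∫ F w dμ / Z`. [folklore] -/
theorem flatness_and_smallBalls_of_anticoncentration
    {X : Type*} [TopologicalSpace X] [CompactSpace X] [MeasurableSpace X] [OpensMeasurableSpace X]
    (μ : Measure X) [IsFiniteMeasure μ] {F w : X → ℝ} (hF : Continuous F) (hw : Continuous w)
    (hF0 : ∀ x, 0 ≤ F x) (hw0 : ∀ x, 0 ≤ w x) {K C_R c : ℝ} (hK : 0 ≤ K) (hCR : 0 ≤ C_R) (hc : 0 < c)
    (hZ : 0 < ∫ y, w y ∂μ) (hdens : ∀ x, w x ≤ K * ∫ y, w y ∂μ)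
    (hR1 : ∀ x₀, 0 < F x₀ → ∀ ε : ℝ, 0 < ε → (μ {x | F x ≤ ε * F x₀}).toReal ≤ C_R * ε ^ c) :
    (∀ x₀, F x₀ ≤ 2 * (2 * K * C_R + 1) ^ (1 / c) * ((∫ x, F x * w x ∂μ) / ∫ y, w y ∂μ)) ∧
    (0 < (∫ x, F x * w x ∂μ) / (∫ y, w y ∂μ) → ∀ ε : ℝ, 0 < ε →
      (∫ x, (if F x ≤ ε * ((∫ x, F x * w x ∂μ) / ∫ y, w y ∂μ) then (1 : ℝ) else 0) * w x ∂μ) /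
          (∫ y, w y ∂μ) ≤ K * C_R * ε ^ c) := by
  set Z : ℝ := ∫ y, w y ∂μ with hZdef
  -- continuous functions on a compact space are integrable for the finite measure `μ`
  have hint : ∀ {f : X → ℝ}, Continuous f → Integrable f μ := fun {f} hf => by
    obtain ⟨C, hC⟩ := isCompact_univ.exists_bound_of_continuousOn hf.continuousOn
    exact (integrable_const C).mono' hf.aestronglyMeasurable
      (Eventually.of_forall fun x => hC x (mem_univ x))
  have hwi : Integrable w μ := hint hw
  have hFwi : Integrable (fun x => F x * w x) μ := hint (hF.mul hw)
  -- the weighted mass of a closed sublevel set `{F ≤ t}` is at most `K Z μ{F ≤ t}`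
  have hmass : ∀ t : ℝ, ∫ x in {x | F x ≤ t}, w x ∂μ ≤ K * Z * (μ {x | F x ≤ t}).toReal := by
    intro t
    have hmeas : MeasurableSet {x | F x ≤ t} := (isClosed_le hF continuous_const).measurableSet
    calc ∫ x in {x | F x ≤ t}, w x ∂μ ≤ ∫ x in {x | F x ≤ t}, K * Z ∂μ := by
          refine setIntegral_mono_on hwi.integrableOn (integrableOn_const) hmeas fun x _ => ?_
          exact hdens x
      _ = K * Z * (μ {x | F x ≤ t}).toReal := by
          rw [setIntegral_const, smul_eq_mul, mul_comm]; rfl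
  by_cases hX : Nonempty X
  swap
  · haveI : IsEmpty X := not_nonempty_iff.mp hX
    refine ⟨fun x₀ => (IsEmpty.false x₀).elim, fun hM ε hε => ?_⟩
    simp [integral_of_isEmpty] at hM
  obtain ⟨xm, -, hxm⟩ := isCompact_univ.exists_isMaxOn univ_nonempty hF.continuousOn
  have hFmax : ∀ x, F x ≤ F xm := fun x => hxm (mem_univ x)
  -- `M ≤ F xm`
  have hM_le : (∫ x, F x * w x ∂μ) / Z ≤ F xm := by
    rw [div_le_iff₀ hZ]
    calc ∫ x, F x * w x ∂μ ≤ ∫ x, F xm * w x ∂μ :=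
          integral_mono hFwi (hwi.const_mul _) fun x => mul_le_mul_of_nonneg_right (hFmax x) (hw0 x)
      _ = F xm * Z := by rw [integral_const_mul]
  constructor
  · -- (a) flatness
    intro x₀
    set A : ℝ := 2 * K * C_R + 1 with hA
    have hApos : 0 < A := by positivity
    set δ : ℝ := A ^ (-(1 / c)) with hδ
    have hδpos : 0 < δ := Real.rpow_pos_of_pos hApos _
    have hδc : δ ^ c = A⁻¹ := by
      rw [hδ, ← Real.rpow_mul hApos.le, neg_mul, one_div, inv_mul_cancel₀ hc.ne', Real.rpow_neg hApos.le,
        Real.rpow_one]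
    have hinvδ : δ⁻¹ = A ^ (1 / c) := by
      rw [hδ, Real.rpow_neg hApos.le, inv_inv]
    by_cases hFm0 : F xm ≤ 0
    · have h0 : F x₀ = 0 := le_antisymm ((hFmax x₀).trans hFm0) (hF0 x₀)
      rw [h0]
      refine mul_nonneg (by positivity) (div_nonneg (integral_nonneg fun x => ?_) hZ.le)
      exact mul_nonneg (hF0 x) (hw0 x)
    push Not at hFm0
    -- mass of the deep sublevel set `B = {F ≤ δ F xm}` is at most `K Z C_R δ^c ≤ Z/2`
    set B : Set X := {x | F x ≤ δ * F xm} with hB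
    have hBmeas : MeasurableSet B := (isClosed_le hF continuous_const).measurableSet
    have hBmass : ∫ x in B, w x ∂μ ≤ Z / 2 := by
      calc ∫ x in B, w x ∂μ ≤ K * Z * (μ B).toReal := hmass _
        _ ≤ K * Z * (C_R * δ ^ c) := by
            refine mul_le_mul_of_nonneg_left (hR1 xm hFm0 δ hδpos) (by positivity)
        _ = Z * (K * C_R / A) := by rw [hδc]; ring
        _ ≤ Z * (1 / 2) := by
            refine mul_le_mul_of_nonneg_left ?_ hZ.le
            rw [div_le_iff₀ hApos, hA]; nlinarith [mul_nonneg hK hCR]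
        _ = Z / 2 := by ring
    -- lower bound for `∫ F w` on the complement of `B`
    have hlow : δ * F xm * (Z / 2) ≤ ∫ x, F x * w x ∂μ := by
      have hcompl : ∫ x in Bᶜ, w x ∂μ = Z - ∫ x in B, w x ∂μ := setIntegral_compl hBmeas hwi
      have h1 : δ * F xm * (Z / 2) ≤ δ * F xm * ∫ x in Bᶜ, w x ∂μ := by
        refine mul_le_mul_of_nonneg_left ?_ (by positivity)
        rw [hcompl]; linarith
      have h2 : δ * F xm * ∫ x in Bᶜ, w x ∂μ = ∫ x in Bᶜ, δ * F xm * w x ∂μ := by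
        rw [integral_const_mul]
      have h3 : ∫ x in Bᶜ, δ * F xm * w x ∂μ ≤ ∫ x in Bᶜ, F x * w x ∂μ := by
        refine setIntegral_mono_on ((hwi.const_mul _).integrableOn) hFwi.integrableOn hBmeas.compl
          fun x hx => ?_
        have hx' : δ * F xm < F x := by
          simpa [hB] using hx
        exact mul_le_mul_of_nonneg_right hx'.le (hw0 x)
      have h4 : ∫ x in Bᶜ, F x * w x ∂μ ≤ ∫ x, F x * w x ∂μ :=
        setIntegral_le_integral hFwi (Eventually.of_forall fun x => mul_nonneg (hF0 x) (hw0 x))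
      linarith
    -- conclude
    set I : ℝ := ∫ x, F x * w x ∂μ with hI
    have hδne : δ ≠ 0 := hδpos.ne'
    have hZne : Z ≠ 0 := hZ.ne'
    have h1 : F xm * (δ * Z) ≤ I * 2 := by
      have : F xm * (δ * Z) = 2 * (δ * F xm * (Z / 2)) := by ring
      linarith
    have hkey : F xm ≤ 2 * δ⁻¹ * (I / Z) := by
      calc F xm = F xm * (δ * Z) / (δ * Z) := by field_simp
        _ ≤ I * 2 / (δ * Z) := by gcongr
        _ = 2 * δ⁻¹ * (I / Z) := by field_simp
    calc F x₀ ≤ F xm := hFmax x₀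
      _ ≤ 2 * δ⁻¹ * (I / Z) := hkey
      _ = 2 * A ^ (1 / c) * (I / Z) := by rw [hinvδ]
  · -- (b) relative small balls
    intro hM ε hε
    set M : ℝ := (∫ x, F x * w x ∂μ) / Z with hMdef
    have hFm : 0 < F xm := lt_of_lt_of_le hM hM_le
    have hsub : {x | F x ≤ ε * M} ⊆ {x | F x ≤ ε * F xm} := fun x hx =>
      le_trans (show F x ≤ ε * M from hx) (mul_le_mul_of_nonneg_left hM_le hε.le)
    have hmeas : MeasurableSet {x | F x ≤ ε * M} := (isClosed_le hF continuous_const).measurableSet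
    have hind : ∫ x, (if F x ≤ ε * M then (1 : ℝ) else 0) * w x ∂μ = ∫ x in {x | F x ≤ ε * M}, w x ∂μ := by
      rw [← integral_indicator hmeas]
      congr 1; ext x
      by_cases hx : F x ≤ ε * M
      · simp [hx]
      · simp [hx]
    rw [hind, div_le_iff₀ hZ]
    calc ∫ x in {x | F x ≤ ε * M}, w x ∂μ ≤ K * Z * (μ {x | F x ≤ ε * M}).toReal := hmass _
      _ ≤ K * Z * (μ {x | F x ≤ ε * F xm}).toReal := by
          refine mul_le_mul_of_nonneg_left ?_ (by positivity)
          exact ENNReal.toReal_mono (measure_ne_top _ _) (measure_mono hsub)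
      _ ≤ K * Z * (C_R * ε ^ c) := mul_le_mul_of_nonneg_left (hR1 xm hFm ε hε) (by positivity)
      _ = K * C_R * ε ^ c * Z := by ring

end Literature.MeasureTheory.Integral
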